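import Literature.NumberTheory.EllipticCurves.VeluNormProofs
import Literature.NumberTheory.EllipticCurves.TorsionCardinality
import Mathlib.Algebra.Polynomial.Reverse
import Mathlib.RingTheory.Ideal.GoingUp
import Mathlib.RingTheory.IntegralClosure.IntegrallyClosed
import Mathlib.GroupTheory.OrderOfElement
import HarnessLib

/-!
# The canonical subgroup from a Hensel factor of the `p`-division polynomial
# (Blakestad–Grant 2023, eq. (4) and Prop. 7: "the roots of `φ_ψ` are precisely the
# `x`-coordinates of the non-trivial points in `G`"; proofs only, valuation-free)

Trunk T-NT-EC (Literature/NumberTheory/EllipticCurves). In Blakestad–Grant's proof of the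
integrality of the universal Mazur–Tate sigma function (*On the universal `p`-adic sigma and
Weierstrass zeta functions*, J. Number Theory 249 (2023), arXiv:1903.02480, §2.2–2.3) the canonical
`p`-isogeny `ψ : E → E/G` is controlled through the `p`-adic Weierstrass factorisation of the
`p`-division polynomial over `R̂`,

  `φ_p(x) = φ_ψ(x)·ξ_ψ(x)`,  `ξ_ψ` monic,  `φ_ψ(x) = px^{(p-1)/2} + ⋯ + ℓ̃₀ ≡ ℓ̃₀ ≡ H (mod p)`  (4)

and the sentence "since `x^{-(p²-p)/2}ξ_ψ(x)` is invertible in `R̂⟦1/x⟧`, the roots of `φ_ψ(x)` are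
precisely the `x`-coordinates of the non-trivial points in `G`", `G ⊂ E(K̄)` being the group of
`K̄`-points of the canonical subgroup (the subgroup of order `p` of the kernel of reduction, which
exists because the reduction is ordinary).

The tree's Vélu files (`VeluOddKernelProofs`, `VeluNormProofs`, `VeluKernelReductionProofs`) take
the kernel as an ABSTRACT finite set of points `G` with the closure properties
`IsOddSubgroupFinset G` and the kernel polynomial `veluD G = Π_{c ∈ x(G∖O)}(X - c)`, together with
the hypothesis `φ_ψ = p·veluD G` (`hφF` there). This file CONSTRUCTS that `G` from the factor
`φ_ψ` alone and proves the quoted sentence, for any Weierstrass curve over any field `F`, any base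
ring `R → F`, any prime ideal `𝔭 ∋ p` of `R` and any factorisation `preΨ'_p = φ·ξ` over `R` with
`ξ` monic and `φ ≡ (unit) (mod 𝔭)` of degree `≤ n`, `p = 2n + 1`:

* `xOf_zsmul_not_mem_range` — if `u = (c, y)` with `1/c ∈ 𝔓` for a prime `𝔓` of a subring
  `S ⊆ F` integrally closed in `F` over which the curve is defined, then NO multiple `k•u ≠ O` has
  an `x`-coordinate in `S` (from `x(k•u)·ΨSq_k(c) = Φ_k(c)` — the tree's
  `mul_eval_ΨSq_of_zsmul_eq`, Silverman AEC Ex. 3.7(d) — read in the variable `1/c`: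
  `x(k•u)·(1/c)·(k² + O(1/c)) = 1 + O(1/c)`, and `1/c ∈ 𝔓`);
* `exists_inv_mem_of_eval_eq_zero` — a root `c` of `φ` has `1/c ∈ S` with `1/c ∈ 𝔓`
  (`1/c` is a root of the reversed polynomial `ℓ̃₀Xⁿ + ⋯ + p ≡ ℓ̃₀Xⁿ (mod 𝔓)`, `ℓ̃₀ ∈ Sˣ`);
* `eval_eq_zero_of_zsmul_eq` — hence every multiple `k•u = (c', y') ≠ O` of a point `u = (c, y)`
  with `φ(c) = 0` again has `φ(c') = 0`: `k•u ∈ E[p]` (`p•u = O` as `ΨSq_p(c) = φ(c)²ξ(c)² = 0`),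
  so `φ(c')ξ(c') = 0`, and `ξ(c') = 0` would make `c'` integral over `S`, i.e. `c' ∈ S`;
* `isOddSubgroupFinset_multiplesFinset`, `card_multiplesFinset` — the multiples
  `G = {k•u : 0 ≤ k < p}` (`multiplesFinset u p`) of a point of odd prime order `p` form an
  `IsOddSubgroupFinset` of cardinality `p`;
* **`eval_eq_zero_of_mem_multiplesFinset`, `veluXVals_multiplesFinset`,
  `C_mul_veluD_multiplesFinset`, `mem_multiplesFinset_iff`** — for `u = (c, y)` with `φ(c) = 0`:
  `x(G ∖ O) =` the set of roots of `φ` in `F`, which therefore number exactly `n` (all simple),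
  `2·#x(G∖O) + 1 = p`, **`C(φₙ)·veluD G = φ`** (`φₙ = p` in Blakestad–Grant's normalisation:
  `φ_ψ = p·D`), and `P ∈ G ↔ P = O ∨ φ(x(P)) = 0` — so `G` does not depend on `u`: it is THE
  canonical subgroup, and it is a group;
* `canonicalSubgroup_of_henselFactor` — the same over an arbitrary base `R → F` and prime
  `𝔭 ∋ p` of `R` (the auxiliary ring is `S =` the integral closure of `R` in `F` with a prime
  `𝔓` over `𝔭`, by lying-over), and `exists_canonicalSubgroup_of_henselFactor` — over an
  algebraically closed `F` (where a point `u` with `φ(x(u)) = 0` exists as soon as `φₙ ≠ 0` in `F`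
  and `n ≠ 0`) there is an `IsOddSubgroupFinset G` with `#G = p`, `2·#x(G∖O) + 1 = p` and
  `C(φₙ)·veluD G = φ`: exactly the kernel data consumed by `VeluKernelReductionProofs`
  (`hφF`, `hcard`).

No valuation on `F`, no completeness and no normality of `R` are used: the "kernel of reduction"
is replaced by the prime `𝔓` of the integral closure, and the group property of the canonical
subgroup by the count `2·#{roots of φ} ≤ p - 1 = #(⟨u⟩ ∖ O)`.

## Sources

* C. Blakestad, D. Grant, *On the universal `p`-adic sigma and Weierstrass zeta functions*,
  J. Number Theory 249 (2023) 348–376 (arXiv:1903.02480), §2.3: eq. (4) and the proof of Prop. 7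
  ("the roots of `φ_ψ(x)` are precisely the `x`-coordinates of the non-trivial points in `G`";
  "`ℓ̃₀` is invertible in `R̂`"). [BlakestadGrant2023]
* J. H. Silverman, *The Arithmetic of Elliptic Curves*, 2nd ed. (2009), Exercise 3.7(d)
  (`x([n]P) = φₙ/ψₙ²`), VII.3.1 (torsion in the kernel of reduction). [SilvermanAEC2009]

Pure proof file: the only new datum is the explicit finite set `multiplesFinset u p` (with body);
no named facts.
-/

noncomputable section

open scoped Classical
open Polynomial

namespace WeierstrassCurve.Affine.Point

/-! ### Reversed polynomials evaluated at `1/c` -/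

section Reflect

variable {S F : Type*} [CommRing S] [Field F]

/-- `Q̃(1/c)·cᴺ = Q(c)` for the reversed polynomial `Q̃ = reflect N Q` (`deg Q ≤ N`, `c ≠ 0`).
[folklore] -/
theorem eval₂_reflect_inv_mul_pow (i : S →+* F) {c : F} (hc : c ≠ 0) (N : ℕ) (Q : S[X])
    (hQ : Q.natDegree ≤ N) : eval₂ i c⁻¹ (reflect N Q) * c ^ N = eval₂ i c Q := by
  letI : Invertible c := invertibleOfNonzero hc
  have h := eval₂_reflect_mul_pow i c N Q hQ
  rwa [invOf_eq_inv] at h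

/-- The constant coefficient of `reflect N Q` is the coefficient of `Xᴺ` in `Q`. [folklore] -/
theorem coeff_zero_reflect (N : ℕ) (Q : S[X]) : (reflect N Q).coeff 0 = Q.coeff N := by
  rw [coeff_reflect, revAt_le (Nat.zero_le N), Nat.sub_zero]

/-- `Q(w) ≡ Q(0) (mod 𝔓)` for `w ∈ 𝔓`. [folklore] -/
theorem mk_eval_eq_mk_coeff_zero (𝔓 : Ideal S) {w : S} (hw : w ∈ 𝔓) (Q : S[X]) :
    Ideal.Quotient.mk 𝔓 (Q.eval w) = Ideal.Quotient.mk 𝔓 (Q.coeff 0) := by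
  rw [← eval₂_hom, Ideal.Quotient.eq_zero_iff_mem.mpr hw, eval₂_at_zero]

end Reflect

/-! ### No multiple of a point with `1/x ∈ 𝔓` has an integral `x`-coordinate -/

section Integral

variable {F : Type*} [Field F] {W : WeierstrassCurve F}
variable {S : Type*} [CommRing S] [Algebra S F] [IsIntegrallyClosedIn S F]
variable {V : WeierstrassCurve S} (hV : V.map (algebraMap S F) = W)
variable (𝔓 : Ideal S) [𝔓.IsPrime]

include hV in
/-- **No multiple `k•u ≠ O` of `u = (c, y)` with `1/c ∈ 𝔓` has `x(k•u) ∈ S`** (`S ⊆ F` integrally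
closed in `F`, the curve defined over `S`, `𝔓 ⊂ S` a prime ideal). From `x(k•u)·ΨSq_k(c) = Φ_k(c)`
(Silverman AEC Ex. 3.7(d)) multiplied by `c^{-k²}`: with `w = 1/c` and the reversed polynomials,
`x(k•u)·Ψ̃(w) = Φ̃(w)` where `Ψ̃(0) = 0` (`deg ΨSq_k ≤ k² - 1`) and `Φ̃(0) = 1` (`Φ_k` monic of
degree `k²`); modulo `𝔓` this reads `x(k•u)·0 = 1` if `x(k•u) ∈ S`. [Blakestad–Grant 2023, proof of
Prop. 7 ("`x^{-(p²-p)/2}ξ_ψ(x)` is invertible in `R̂⟦1/x⟧`")] [folklore] -/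
theorem xOf_zsmul_not_mem_range {c y : F} (h : W.toAffine.Nonsingular c y) {w : S} (hw : w ∈ 𝔓)
    (hwc : algebraMap S F w * c = 1) {k : ℤ} {c' y' : F} (h' : W.toAffine.Nonsingular c' y')
    (hk : k • (some c y h : W.toAffine.Point) = some c' y' h') :
    c' ∉ Set.range (algebraMap S F) := by
  rintro ⟨t, rfl⟩
  have hinj := IsIntegralClosure.algebraMap_injective S S F
  have hc : c ≠ 0 := by
    rintro rfl
    rw [mul_zero] at hwc
    exact zero_ne_one hwc
  have hk0 : k ≠ 0 := by
    rintro rfl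
    rw [zero_smul] at hk
    exact some_ne_zero _ hk.symm
  set N := k.natAbs ^ 2 with hN
  have hkabs : 1 ≤ k.natAbs := Int.natAbs_pos.mpr hk0
  have hN1 : 1 ≤ N := Nat.one_le_pow _ _ hkabs
  have hmul := W.mul_eval_ΨSq_of_zsmul_eq h k h' hk
  have hΨ : W.ΨSq k = (V.ΨSq k).map (algebraMap S F) := by rw [← hV, map_ΨSq]
  have hΦ : W.Φ k = (V.Φ k).map (algebraMap S F) := by rw [← hV, map_Φ]
  rw [hΨ, hΦ, eval_map, eval_map] at hmul
  have hdΨ : (V.ΨSq k).natDegree ≤ N := (V.natDegree_ΨSq_le k).trans (Nat.sub_le _ _)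
  have hdΦ : (V.Φ k).natDegree ≤ N := V.natDegree_Φ_le k
  rw [← eval₂_reflect_inv_mul_pow _ hc N _ hdΨ, ← eval₂_reflect_inv_mul_pow _ hc N _ hdΦ] at hmul
  have hcinv : c⁻¹ = algebraMap S F w := (eq_inv_of_mul_eq_one_left hwc).symm
  rw [hcinv, eval₂_hom, eval₂_hom, ← mul_assoc, ← _root_.map_mul, mul_left_inj' (pow_ne_zero N hc)] at hmul
  have hq := congrArg (Ideal.Quotient.mk 𝔓) (hinj hmul)
  rw [_root_.map_mul, mk_eval_eq_mk_coeff_zero 𝔓 hw, mk_eval_eq_mk_coeff_zero 𝔓 hw, coeff_zero_reflect,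
    coeff_zero_reflect, coeff_Φ, _root_.map_one,
    coeff_eq_zero_of_natDegree_lt ((V.natDegree_ΨSq_le k).trans_lt (by omega)), _root_.map_zero,
    mul_zero] at hq
  haveI := Ideal.Quotient.nontrivial_iff.mpr (Ideal.IsPrime.ne_top ‹𝔓.IsPrime›)
  exact zero_ne_one hq

/-- **A root `c` of the Hensel factor has `1/c ∈ 𝔓`.** If `φ ∈ S[X]` has `deg φ ≤ n`, unit
constant coefficient and all other coefficients in the prime `𝔓`, and `φ(c) = 0` in `F`, then
`c ≠ 0` and `w = 1/c` lies in `S` (it is a root of the reversed polynomial `φ₀Xⁿ + φ₁Xⁿ⁻¹ + ⋯`,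
monic up to the unit `φ₀`, and `S` is integrally closed in `F`) with `w ∈ 𝔓` (modulo `𝔓` that
polynomial is `φ₀Xⁿ`). [Blakestad–Grant 2023, eq. (4) (`φ_ψ ≡ ℓ̃₀ (mod p)`, `ℓ̃₀ ∈ R̂ˣ`)] [folklore] -/
theorem exists_inv_mem_of_eval_eq_zero {n : ℕ} {φ : S[X]} (hφn : φ.natDegree ≤ n)
    (hφ0 : IsUnit (φ.coeff 0)) (hφi : ∀ i, 1 ≤ i → φ.coeff i ∈ 𝔓) {c : F}
    (hc : (φ.map (algebraMap S F)).eval c = 0) :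
    ∃ w ∈ 𝔓, algebraMap S F w * c = 1 := by
  have hinj := IsIntegralClosure.algebraMap_injective S S F
  haveI : Nontrivial S := RingHom.domain_nontrivial (algebraMap S F)
  have hc' : φ.eval₂ (algebraMap S F) c = 0 := by rwa [eval_map] at hc
  have hc0 : c ≠ 0 := by
    rintro rfl
    rw [eval₂_at_zero] at hc'
    exact hφ0.ne_zero (hinj (by rw [hc', _root_.map_zero]))
  set Q := reflect n φ with hQ
  have hQn : Q.coeff n = φ.coeff 0 := by rw [hQ, coeff_reflect, revAt_le le_rfl, Nat.sub_self]
  have hQdeg : Q.natDegree ≤ n :=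
    natDegree_reflect_le.trans (max_le le_rfl hφn)
  have hroot : Q.eval₂ (algebraMap S F) c⁻¹ = 0 := by
    have h := eval₂_reflect_inv_mul_pow (algebraMap S F) hc0 n φ hφn
    rw [hc'] at h
    exact (mul_eq_zero.mp h).resolve_right (pow_ne_zero n hc0)
  obtain ⟨v, hv⟩ := hφ0
  set Q₁ := C (↑v⁻¹ : S) * Q with hQ₁
  have hQ₁monic : Q₁.Monic := by
    refine monic_of_natDegree_le_of_coeff_eq_one n ((natDegree_C_mul_le _ _).trans hQdeg) ?_
    rw [hQ₁, coeff_C_mul, hQn, ← hv, Units.inv_mul]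
  have hint : _root_.IsIntegral S c⁻¹ := ⟨Q₁, hQ₁monic, by rw [hQ₁, eval₂_mul, eval₂_C, hroot, mul_zero]⟩
  obtain ⟨w, hw⟩ := IsIntegrallyClosedIn.algebraMap_eq_of_integral hint
  refine ⟨w, ?_, by rw [hw, inv_mul_cancel₀ hc0]⟩
  -- `w ∈ 𝔓`: reduce `Q(w) = 0` modulo `𝔓`, where `Q ≡ φ₀ Xⁿ`
  have hQw : Q.eval w = 0 := hinj (by rw [← eval₂_hom, hw, hroot, _root_.map_zero])
  haveI : IsDomain (S ⧸ 𝔓) := Ideal.Quotient.isDomain 𝔓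
  have hred : Q.map (Ideal.Quotient.mk 𝔓) = C (Ideal.Quotient.mk 𝔓 (φ.coeff 0)) * X ^ n := by
    ext i
    rw [coeff_map, coeff_C_mul, coeff_X_pow, hQ, coeff_reflect]
    by_cases hi : i = n
    · rw [hi, if_pos rfl, mul_one, revAt_le le_rfl, Nat.sub_self]
    · rw [if_neg hi, mul_zero, Ideal.Quotient.eq_zero_iff_mem]
      by_cases hin : i ≤ n
      · rw [revAt_le hin]
        exact hφi _ (by omega)
      · rw [revAt_eq_self_of_lt (not_le.mp hin),
          coeff_eq_zero_of_natDegree_lt (hφn.trans_lt (not_le.mp hin))]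
        exact 𝔓.zero_mem
  have h0 : Ideal.Quotient.mk 𝔓 (φ.coeff 0) * Ideal.Quotient.mk 𝔓 w ^ n = 0 := by
    have := congrArg (Ideal.Quotient.mk 𝔓) hQw
    rwa [_root_.map_zero, ← eval₂_hom, ← eval_map, hred, eval_mul, eval_C, eval_pow, eval_X] at this
  have hu : Ideal.Quotient.mk 𝔓 (φ.coeff 0) ≠ 0 := by
    rw [← hv]
    exact (Units.map (Ideal.Quotient.mk 𝔓 : S →* S ⧸ 𝔓) v).ne_zero
  exact Ideal.Quotient.eq_zero_iff_mem.mp (eq_zero_of_pow_eq_zero ((mul_eq_zero.mp h0).resolve_left hu))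

include hV in
/-- **Multiples of a point over a root of the Hensel factor stay over roots of the Hensel factor.**
Let `preΨ'_p = φ·ξ` over `S` with `ξ` monic and `φ` as in `exists_inv_mem_of_eval_eq_zero`
(`p = 2n + 1`). If `u = (c, y)` with `φ(c) = 0` and `k•u = (c', y') ≠ O`, then `φ(c') = 0`:
`p•u = O` since `ΨSq_p(c) = (φξ)²(c) = 0`, so `k•u ∈ E[p]` and `φ(c')ξ(c') = 0`; but `ξ(c') = 0`
would make `c'` integral over `S`, contradicting `xOf_zsmul_not_mem_range`.
[Blakestad–Grant 2023, proof of Prop. 7] [folklore] -/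
theorem eval_eq_zero_of_zsmul_eq {p n : ℕ} (hpn : 2 * n + 1 = p) {φ ξ : S[X]}
    (hfac : V.preΨ' p = φ * ξ) (hξ : ξ.Monic) (hφn : φ.natDegree ≤ n) (hφ0 : IsUnit (φ.coeff 0))
    (hφi : ∀ i, 1 ≤ i → φ.coeff i ∈ 𝔓) {c y : F} (h : W.toAffine.Nonsingular c y)
    (hc : (φ.map (algebraMap S F)).eval c = 0) {k : ℤ} {c' y' : F}
    (h' : W.toAffine.Nonsingular c' y') (hk : k • (some c y h : W.toAffine.Point) = some c' y' h') :
    (φ.map (algebraMap S F)).eval c' = 0 := by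
  obtain ⟨w, hw, hwc⟩ := exists_inv_mem_of_eval_eq_zero 𝔓 hφn hφ0 hφi hc
  have hnot := xOf_zsmul_not_mem_range hV 𝔓 h hw hwc h' hk
  have hodd : ¬Even p := by rw [← hpn, Nat.not_even_iff_odd]; exact odd_two_mul_add_one n
  have hΨfac : W.ΨSq (p : ℕ) = ((φ * ξ) ^ 2).map (algebraMap S F) := by
    rw [← hV, map_ΨSq, ΨSq_ofNat, if_neg hodd, mul_one, hfac]
  have hpu : ((p : ℕ) : ℤ) • (some c y h : W.toAffine.Point) = 0 := by
    rw [W.zsmul_some_eq_zero_iff_eval_ΨSq h, hΨfac, Polynomial.map_pow, Polynomial.map_mul,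
      eval_pow, eval_mul, hc, zero_mul, zero_pow two_ne_zero]
  have hpu' : ((p : ℕ) : ℤ) • (some c' y' h' : W.toAffine.Point) = 0 := by
    rw [← hk, smul_smul, mul_comm, ← smul_smul, hpu, smul_zero]
  have hΨ' := (W.zsmul_some_eq_zero_iff_eval_ΨSq h' p).mp hpu'
  rw [hΨfac, Polynomial.map_pow, Polynomial.map_mul, eval_pow, eval_mul] at hΨ'
  rcases mul_eq_zero.mp (eq_zero_of_pow_eq_zero hΨ') with hφ' | hξ'
  · exact hφ'
  · exfalso
    refine hnot ?_
    have hint : _root_.IsIntegral S c' := ⟨ξ, hξ, by rwa [eval_map] at hξ'⟩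
    obtain ⟨t, ht⟩ := IsIntegrallyClosedIn.algebraMap_eq_of_integral hint
    exact ⟨t, ht⟩

end Integral

/-! ### The multiples of a point of odd prime order -/

section Multiples

variable {F : Type*} [Field F] {W : WeierstrassCurve F}

/-- The finite set of multiples `{k•u : 0 ≤ k < p}` of a point `u`. [folklore] -/
def multiplesFinset (u : W.toAffine.Point) (p : ℕ) : Finset W.toAffine.Point :=
  (Finset.range p).image fun k => k • u

/-- Membership in `multiplesFinset u p` for a point of order `p`: `v = k•u` for some `k`. [folklore] -/
theorem mem_multiplesFinset_iff_exists {u : W.toAffine.Point} {p : ℕ} (hu : addOrderOf u = p)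
    (hp : 0 < p) (v : W.toAffine.Point) : v ∈ multiplesFinset u p ↔ ∃ k : ℕ, k • u = v := by
  unfold multiplesFinset
  rw [Finset.mem_image]
  constructor
  · rintro ⟨k, -, rfl⟩
    exact ⟨k, rfl⟩
  · rintro ⟨k, rfl⟩
    refine ⟨k % p, Finset.mem_range.mpr (Nat.mod_lt _ hp), ?_⟩
    rw [← hu, mod_addOrderOf_nsmul]

/-- `#{k•u : 0 ≤ k < p} = p` for a point of order `p`. [folklore] -/
theorem card_multiplesFinset {u : W.toAffine.Point} {p : ℕ} (hu : addOrderOf u = p) :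
    (multiplesFinset u p).card = p := by
  unfold multiplesFinset
  rw [Finset.card_image_of_injOn, Finset.card_range]
  intro k hk l hl hkl
  have h := (nsmul_inj_mod (x := u)).mp hkl
  rwa [hu, Nat.mod_eq_of_lt (Finset.mem_range.mp hk), Nat.mod_eq_of_lt (Finset.mem_range.mp hl)] at h

/-- **The multiples of a point of odd prime order form an `IsOddSubgroupFinset`.** [folklore] -/
theorem isOddSubgroupFinset_multiplesFinset {u : W.toAffine.Point} {p : ℕ} (hp : p.Prime) (hp2 : p ≠ 2)
    (hu : addOrderOf u = p) : IsOddSubgroupFinset (multiplesFinset u p) := by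
  have hp0 : 0 < p := hp.pos
  have hpu : p • u = 0 := by rw [← hu]; exact addOrderOf_nsmul_eq_zero u
  refine ⟨?_, ?_, ?_, ?_⟩
  · exact (mem_multiplesFinset_iff_exists hu hp0 0).mpr ⟨0, zero_nsmul u⟩
  · intro v hv v' hv'
    obtain ⟨k, rfl⟩ := (mem_multiplesFinset_iff_exists hu hp0 v).mp hv
    obtain ⟨l, rfl⟩ := (mem_multiplesFinset_iff_exists hu hp0 v').mp hv'
    exact (mem_multiplesFinset_iff_exists hu hp0 _).mpr ⟨k + l, add_nsmul u k l⟩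
  · intro v hv
    obtain ⟨k, rfl⟩ := (mem_multiplesFinset_iff_exists hu hp0 v).mp hv
    refine (mem_multiplesFinset_iff_exists hu hp0 _).mpr ⟨(p - 1) * k, ?_⟩
    apply eq_neg_of_add_eq_zero_left
    obtain ⟨m, hm⟩ : ∃ m, p = m + 1 := ⟨p - 1, (Nat.sub_one_add_one hp.ne_zero).symm⟩
    rw [← add_nsmul, hm, Nat.add_sub_cancel, show m * k + k = k * (m + 1) by ring, mul_nsmul', ← hm, hpu,
      nsmul_zero]
  · intro v hv hneg
    obtain ⟨k, rfl⟩ := (mem_multiplesFinset_iff_exists hu hp0 v).mp hv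
    have h2 : (2 * k) • u = 0 := by
      rw [mul_nsmul', two_nsmul]
      nth_rewrite 1 [← hneg]
      exact neg_add_cancel _
    have hdvd : p ∣ 2 * k := by rw [← hu]; exact addOrderOf_dvd_iff_nsmul_eq_zero.mpr h2
    rcases hp.dvd_mul.mp hdvd with h | h
    · exact absurd (Nat.le_of_dvd two_pos h) (by have := hp.two_le; omega)
    · rw [← hu] at h
      exact addOrderOf_dvd_iff_nsmul_eq_zero.mp h

end Multiples

/-! ### The canonical subgroup: `x(G ∖ O) = {roots of φ}` and `C(φₙ)·D = φ` -/

section Canonical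

variable {F : Type*} [Field F] {W : WeierstrassCurve F}
variable {S : Type*} [CommRing S] [Algebra S F] [IsIntegrallyClosedIn S F]
variable {V : WeierstrassCurve S} (hV : V.map (algebraMap S F) = W)
variable (𝔓 : Ideal S) [𝔓.IsPrime]
variable {p n : ℕ} (hpn : 2 * n + 1 = p) {φ ξ : S[X]}
  (hfac : V.preΨ' p = φ * ξ) (hξ : ξ.Monic) (hφn : φ.natDegree ≤ n) (hφ0 : IsUnit (φ.coeff 0))
  (hφi : ∀ i, 1 ≤ i → φ.coeff i ∈ 𝔓) {c y : F} (h : W.toAffine.Nonsingular c y)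
  (hc : (φ.map (algebraMap S F)).eval c = 0)

omit [IsIntegrallyClosedIn S F] in
include hV hpn hfac hc in
/-- `p•u = O` for a point `u` over a root of the factor `φ` of `preΨ'_p`. [folklore] -/
theorem prime_nsmul_eq_zero_of_eval_eq_zero : p • (some c y h : W.toAffine.Point) = 0 := by
  have hodd : ¬Even p := by rw [← hpn, Nat.not_even_iff_odd]; exact odd_two_mul_add_one n
  have hΨfac : W.ΨSq (p : ℕ) = ((φ * ξ) ^ 2).map (algebraMap S F) := by
    rw [← hV, map_ΨSq, ΨSq_ofNat, if_neg hodd, mul_one, hfac]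
  rw [← natCast_zsmul, W.zsmul_some_eq_zero_iff_eval_ΨSq h, hΨfac, Polynomial.map_pow,
    Polynomial.map_mul, eval_pow, eval_mul, hc, zero_mul, zero_pow two_ne_zero]

omit [IsIntegrallyClosedIn S F] in
include hV hpn hfac hc in
/-- Such a point has order exactly `p` (`p` prime). [folklore] -/
theorem addOrderOf_eq_of_eval_eq_zero (hp : p.Prime) : addOrderOf (some c y h : W.toAffine.Point) = p := by
  haveI := Fact.mk hp
  exact addOrderOf_eq_prime (prime_nsmul_eq_zero_of_eval_eq_zero hV hpn hfac h hc) (some_ne_zero h)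

include hV hpn hfac hξ hφn hφ0 hφi hc in
/-- **Every point of `G ∖ O`, `G = {k•u}`, lies over a root of `φ`.**
[Blakestad–Grant 2023, proof of Prop. 7] [folklore] -/
theorem eval_eq_zero_of_mem_multiplesFinset {v : W.toAffine.Point}
    (hv : v ∈ (multiplesFinset (some c y h) p).erase 0) : (φ.map (algebraMap S F)).eval (xOf v) = 0 := by
  obtain ⟨hv0, hvG⟩ := Finset.mem_erase.mp hv
  obtain ⟨k, -, rfl⟩ := Finset.mem_image.mp hvG
  rcases hkv : k • (some c y h : W.toAffine.Point) with _ | ⟨c', y', h'⟩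
  · exact (hv0 hkv).elim
  · rw [xOf_some]
    rw [← natCast_zsmul] at hkv
    exact eval_eq_zero_of_zsmul_eq hV 𝔓 hpn hfac hξ hφn hφ0 hφi h hc h' hkv

include hφ0 in
/-- `φ ≠ 0` over `F` (its constant coefficient is a unit of `S ⊆ F`). [folklore] -/
theorem map_ne_zero_of_isUnit_coeff_zero : φ.map (algebraMap S F) ≠ 0 := by
  intro h0
  have hinj := IsIntegralClosure.algebraMap_injective S S F
  haveI : Nontrivial S := RingHom.domain_nontrivial (algebraMap S F)
  have := congrArg (Polynomial.coeff · 0) h0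
  simp only [coeff_map, coeff_zero] at this
  exact hφ0.ne_zero (hinj (by rw [this, _root_.map_zero]))

include hV hpn hfac hξ hφn hφ0 hφi hc in
/-- **`x(G ∖ O)` is the set of roots of `φ`, which are `n` in number** (`G = {k•u}`, `p = 2n + 1`
prime): `x(G∖O) ⊆ roots(φ)` by `eval_eq_zero_of_mem_multiplesFinset`, `#x(G∖O) = (p-1)/2 = n`
(the fibres of `x` on `G ∖ O` are the pairs `±v`), and `#roots(φ) ≤ deg φ ≤ n`.
[Blakestad–Grant 2023, proof of Prop. 7] [folklore] -/
theorem veluXVals_multiplesFinset (hp : p.Prime) :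
    veluXVals (multiplesFinset (some c y h) p) = (φ.map (algebraMap S F)).roots.toFinset ∧
      (veluXVals (multiplesFinset (some c y h) p)).card = n := by
  set G := multiplesFinset (some c y h) p with hG
  have hp2 : p ≠ 2 := by omega
  have hord := addOrderOf_eq_of_eval_eq_zero hV hpn hfac h hc hp
  have hOdd : IsOddSubgroupFinset G := isOddSubgroupFinset_multiplesFinset hp hp2 hord
  have hcardG : G.card = p := card_multiplesFinset hord
  have hcardX : (veluXVals G).card = n := by
    have h1 := card_erase_zero_eq hOdd
    rw [Finset.card_erase_of_mem hOdd.zero_mem, hcardG] at h1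
    omega
  have hφF := map_ne_zero_of_isUnit_coeff_zero (F := F) hφ0
  have hsub : veluXVals G ⊆ (φ.map (algebraMap S F)).roots.toFinset := by
    intro a ha
    obtain ⟨v, hv, rfl⟩ := mem_veluXVals_iff.mp ha
    rw [Multiset.mem_toFinset, mem_roots hφF, IsRoot.def]
    exact eval_eq_zero_of_mem_multiplesFinset hV 𝔓 hpn hfac hξ hφn hφ0 hφi h hc hv
  have hle : (φ.map (algebraMap S F)).roots.toFinset.card ≤ (veluXVals G).card := by
    rw [hcardX]
    exact (Multiset.toFinset_card_le _).trans ((card_roots' _).trans ((natDegree_map_le).trans hφn))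
  exact ⟨Finset.eq_of_subset_of_card_le hsub hle, hcardX⟩

include hV hpn hfac hξ hφn hφ0 hφi hc in
/-- **`C(φₙ)·D = φ`**: the kernel polynomial `D = veluD G = Π_{c ∈ x(G∖O)}(X - c)` of `G = {k•u}` is
`φ` divided by its top coefficient (`φₙ = p` in Blakestad–Grant's normalisation `φ_ψ = p·D`,
eq. (4)); in particular `deg φ = n` and `φ` has `n` simple roots in `F`.
[Blakestad–Grant 2023, eq. (4) and proof of Prop. 7] [cite: BlakestadGrant2023, Prop. 7] -/
theorem C_mul_veluD_multiplesFinset (hp : p.Prime) :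
    C (algebraMap S F (φ.coeff n)) * veluD (multiplesFinset (some c y h) p) = φ.map (algebraMap S F) := by
  set G := multiplesFinset (some c y h) p with hG
  set φF := φ.map (algebraMap S F) with hφFdef
  obtain ⟨hX, hcardX⟩ := veluXVals_multiplesFinset hV 𝔓 hpn hfac hξ hφn hφ0 hφi h hc hp
  have hφF0 : φF ≠ 0 := map_ne_zero_of_isUnit_coeff_zero (F := F) hφ0
  -- `D ∣ φ`
  have hdvd : veluD G ∣ φF := by
    have hD : veluD G = ((veluXVals G).val.map fun a => X - C a).prod := Finset.prod_eq_multiset_prod _ _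
    rw [hD, Multiset.prod_X_sub_C_dvd_iff_le_roots hφF0, Multiset.le_iff_subset (veluXVals G).nodup]
    intro a ha
    have ha' : a ∈ veluXVals G := ha
    rw [hX, Multiset.mem_toFinset] at ha'
    exact ha'
  obtain ⟨q, hq⟩ := hdvd
  have hDmonic := monic_veluD G
  have hDdeg : (veluD G).natDegree = n := by rw [natDegree_veluD, hcardX]
  have hq0 : q ≠ 0 := by rintro rfl; rw [mul_zero] at hq; exact hφF0 hq
  have hqdeg : q.natDegree = 0 := by
    have h1 : φF.natDegree ≤ n := natDegree_map_le.trans hφn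
    rw [hq, natDegree_mul hDmonic.ne_zero hq0, hDdeg] at h1
    omega
  have hqC : q = C (q.coeff 0) := eq_C_of_natDegree_eq_zero hqdeg
  have hcoeff : φF.coeff n = q.coeff 0 := by
    rw [hq, hqC, coeff_mul_C, ← hDdeg, hDmonic.coeff_natDegree, one_mul, coeff_C_zero]
  rw [hq, hqC, ← hcoeff, hφFdef, coeff_map, mul_comm]

include hV hpn hfac hξ hφn hφ0 hφi hc in
/-- **`G = {k•u}` is the set of points `P` with `P = O` or `φ(x(P)) = 0`** — in particular it does
not depend on the choice of `u`: it is the canonical subgroup, "the roots of `φ_ψ` are precisely the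
`x`-coordinates of the non-trivial points in `G`". [Blakestad–Grant 2023, proof of Prop. 7]
[cite: BlakestadGrant2023, Prop. 7] -/
theorem mem_multiplesFinset_iff (hp : p.Prime) (P : W.toAffine.Point) :
    P ∈ multiplesFinset (some c y h) p ↔ P = 0 ∨ (φ.map (algebraMap S F)).eval (xOf P) = 0 := by
  set G := multiplesFinset (some c y h) p with hG
  have hp2 : p ≠ 2 := by omega
  have hord := addOrderOf_eq_of_eval_eq_zero hV hpn hfac h hc hp
  have hOdd : IsOddSubgroupFinset G := isOddSubgroupFinset_multiplesFinset hp hp2 hord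
  obtain ⟨hX, -⟩ := veluXVals_multiplesFinset hV 𝔓 hpn hfac hξ hφn hφ0 hφi h hc hp
  have hφF0 := map_ne_zero_of_isUnit_coeff_zero (F := F) hφ0
  constructor
  · intro hP
    by_cases hP0 : P = 0
    · exact Or.inl hP0
    · exact Or.inr (eval_eq_zero_of_mem_multiplesFinset hV 𝔓 hpn hfac hξ hφn hφ0 hφi h hc
        (Finset.mem_erase.mpr ⟨hP0, hP⟩))
  · rintro (rfl | hP)
    · exact hOdd.zero_mem
    · by_cases hP0 : P = 0
      · rw [hP0]; exact hOdd.zero_mem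
      have hx : xOf P ∈ veluXVals G := by
        rw [hX, Multiset.mem_toFinset, mem_roots hφF0]
        exact hP
      obtain ⟨v, hv, hxv⟩ := mem_veluXVals_iff.mp hx
      obtain ⟨hv0, hvG⟩ := Finset.mem_erase.mp hv
      rcases eq_or_eq_neg_of_xOf_eq hP0 hv0 hxv.symm with rfl | rfl
      · exact hvG
      · exact hOdd.neg_mem v hvG

end Canonical

/-! ### Over an arbitrary base `R → F`: the integral closure and a prime over `𝔭` -/

section OverBase

variable {R F : Type*} [CommRing R] [Field F] [Algebra R F]
variable {V : WeierstrassCurve R} {W : WeierstrassCurve F} (hVW : V.map (algebraMap R F) = W)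
variable (𝔭 : Ideal R) [𝔭.IsPrime] (hker : RingHom.ker (algebraMap R F) ≤ 𝔭)
variable {p n : ℕ} (hp : p.Prime) (hpn : 2 * n + 1 = p) {φ ξ : R[X]}
  (hfac : V.preΨ' p = φ * ξ) (hξ : ξ.Monic) (hφn : φ.natDegree ≤ n) (hφ0 : IsUnit (φ.coeff 0))
  (hφi : ∀ i, 1 ≤ i → φ.coeff i ∈ 𝔭) {c y : F} (h : W.toAffine.Nonsingular c y)
  (hc : (φ.map (algebraMap R F)).eval c = 0)

include hVW hker hp hpn hfac hξ hφn hφ0 hφi hc in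
/-- **The canonical subgroup from a Hensel factor of the `p`-division polynomial.** Let `R → F` be
a ring map to a field, `𝔭 ⊂ R` a prime containing its kernel, `p = 2n + 1` a prime with `p ∈ 𝔭`,
`V` a Weierstrass curve over `R` with `preΨ'_p(V) = φ·ξ`, `ξ` monic, `deg φ ≤ n`, `φ₀ ∈ Rˣ` and
`φᵢ ∈ 𝔭` for `i ≥ 1` (Blakestad–Grant's (4): `φ_ψ = px^{(p-1)/2} + ⋯ + ℓ̃₀ ≡ ℓ̃₀ (mod p)`), and let
`u = (c, y)` be a point of `W = V ⊗ F` with `φ(c) = 0`. Then `G = {k•u : 0 ≤ k < p}` is an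
`IsOddSubgroupFinset` with `#G = p`, `2·#x(G∖O) + 1 = p`, `C(φₙ)·veluD G = φ` and
`P ∈ G ↔ P = O ∨ φ(x(P)) = 0`. Proof: apply the preceding section to the integral closure `S` of
`R` in `F` and a prime `𝔓` of `S` over `𝔭` (lying over). [Blakestad–Grant 2023, eq. (4) and
proof of Prop. 7 ("the roots of `φ_ψ(x)` are precisely the `x`-coordinates of the non-trivial
points in `G`")] [cite: BlakestadGrant2023, Prop. 7] -/
theorem canonicalSubgroup_of_henselFactor :
    IsOddSubgroupFinset (multiplesFinset (some c y h) p) ∧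
      (multiplesFinset (some c y h) p).card = p ∧
      2 * (veluXVals (multiplesFinset (some c y h) p)).card + 1 = p ∧
      C (algebraMap R F (φ.coeff n)) * veluD (multiplesFinset (some c y h) p) = φ.map (algebraMap R F) ∧
      ∀ P : W.toAffine.Point,
        P ∈ multiplesFinset (some c y h) p ↔ P = 0 ∨ (φ.map (algebraMap R F)).eval (xOf P) = 0 := by
  -- the integral closure `S` of `R` in `F` and a prime `𝔓` of `S` over `𝔭`
  set S := integralClosure R F with hSdef
  have hbot : (⊥ : Ideal S).comap (algebraMap R S) ≤ 𝔭 := by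
    intro r hr
    rw [Ideal.mem_comap, Ideal.mem_bot] at hr
    apply hker
    rw [RingHom.mem_ker, IsScalarTower.algebraMap_apply R S F, hr, _root_.map_zero]
  obtain ⟨𝔓, -, h𝔓, hcomap⟩ := Ideal.exists_ideal_over_prime_of_isIntegral 𝔭 (⊥ : Ideal S) hbot
  haveI := h𝔓
  -- transfer the data to `S`
  have halg : (algebraMap S F).comp (algebraMap R S) = algebraMap R F := (IsScalarTower.algebraMap_eq R S F).symm
  set VS := V.map (algebraMap R S) with hVS
  have hV : VS.map (algebraMap S F) = W := by rw [hVS, WeierstrassCurve.map_map, halg, hVW]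
  set φS := φ.map (algebraMap R S) with hφS
  set ξS := ξ.map (algebraMap R S) with hξS
  have hφSF : φS.map (algebraMap S F) = φ.map (algebraMap R F) := by rw [hφS, Polynomial.map_map, halg]
  have hfacS : VS.preΨ' p = φS * ξS := by rw [hVS, map_preΨ', hfac, Polynomial.map_mul]
  have hξS' : ξS.Monic := hξ.map _
  have hφSn : φS.natDegree ≤ n := natDegree_map_le.trans hφn
  have hφS0 : IsUnit (φS.coeff 0) := by rw [hφS, coeff_map]; exact hφ0.map _
  have hφSi : ∀ i, 1 ≤ i → φS.coeff i ∈ 𝔓 := by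
    intro i hi
    rw [hφS, coeff_map, ← Ideal.mem_comap, hcomap]
    exact hφi i hi
  have hcS : (φS.map (algebraMap S F)).eval c = 0 := by rw [hφSF]; exact hc
  have hp2 : p ≠ 2 := by omega
  have hord := addOrderOf_eq_of_eval_eq_zero hV hpn hfacS h hcS hp
  obtain ⟨hX, hcardX⟩ := veluXVals_multiplesFinset hV 𝔓 hpn hfacS hξS' hφSn hφS0 hφSi h hcS hp
  refine ⟨isOddSubgroupFinset_multiplesFinset hp hp2 hord, card_multiplesFinset hord, by omega, ?_, ?_⟩
  · have hD := C_mul_veluD_multiplesFinset hV 𝔓 hpn hfacS hξS' hφSn hφS0 hφSi h hcS hp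
    rwa [hφSF, hφS, coeff_map, ← IsScalarTower.algebraMap_apply R S F] at hD
  · intro P
    rw [mem_multiplesFinset_iff hV 𝔓 hpn hfacS hξS' hφSn hφS0 hφSi h hcS hp P, hφSF]

include hVW hker hp hpn hfac hξ hφn hφ0 hφi in
/-- **Existence of the canonical subgroup as kernel data** over an algebraically closed `F`: if
moreover `n ≠ 0`, `φₙ ≠ 0` in `F` and `Δ(W) ≠ 0`, there is an `IsOddSubgroupFinset G` of `W(F)` with
`#G = p`, `2·#x(G∖O) + 1 = p`, `C(φₙ)·veluD G = φ` and `G ∖ O = {P : φ(x(P)) = 0}` — the input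
`hφF`/`hcard` of `VeluKernelReductionProofs` (with `φₙ = p`: `φ = p·veluD G`). A point over a
root of `φ` exists since `F` is algebraically closed. [Blakestad–Grant 2023, eq. (4), Prop. 7]
[cite: BlakestadGrant2023, Prop. 7] -/
theorem exists_canonicalSubgroup_of_henselFactor [IsAlgClosed F] (hn : n ≠ 0)
    (hφnF : algebraMap R F (φ.coeff n) ≠ 0) (hΔ : W.Δ ≠ 0) :
    ∃ G : Finset W.toAffine.Point, IsOddSubgroupFinset G ∧ G.card = p ∧
      2 * (veluXVals G).card + 1 = p ∧
      C (algebraMap R F (φ.coeff n)) * veluD G = φ.map (algebraMap R F) ∧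
      ∀ P : W.toAffine.Point, P ∈ G ↔ P = 0 ∨ (φ.map (algebraMap R F)).eval (xOf P) = 0 := by
  set φF := φ.map (algebraMap R F) with hφF
  -- a root `c` of `φ` in `F`
  have hdeg : φF.natDegree = n := by
    refine le_antisymm (natDegree_map_le.trans hφn) (le_natDegree_of_ne_zero ?_)
    rwa [hφF, coeff_map]
  have hdeg' : φF.degree ≠ 0 := by
    rw [degree_eq_natDegree (fun h0 => hφnF (by rw [← coeff_map, ← hφF, h0, coeff_zero])), hdeg]
    exact_mod_cast hn
  obtain ⟨c, hc⟩ := IsAlgClosed.exists_root φF hdeg'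
  -- an ordinate `y` over `c`
  set g : F[X] := X ^ 2 + C (W.a₁ * c + W.a₃) * X - C (c ^ 3 + W.a₂ * c ^ 2 + W.a₄ * c + W.a₆) with hg
  have hgdeg : g.degree = 2 := by
    rw [hg]
    compute_degree!
  obtain ⟨y, hy⟩ := IsAlgClosed.exists_root g (by rw [hgdeg]; exact two_ne_zero)
  have heq : W.toAffine.Equation c y := by
    rw [Affine.equation_iff]
    simp only [IsRoot.def, hg, eval_sub, eval_add, eval_pow, eval_X, eval_mul, eval_C] at hy
    linear_combination hy
  have hns : W.toAffine.Nonsingular c y := (Affine.equation_iff_nonsingular_of_Δ_ne_zero hΔ).mp heq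
  exact ⟨_, canonicalSubgroup_of_henselFactor hVW 𝔭 hker hp hpn hfac hξ hφn hφ0 hφi hns hc⟩

end OverBase

end WeierstrassCurve.Affine.Point
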